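import Literature.NumberTheory.EllipticCurves.PAdicTwoVariableColemanImageCocycleOfUnits
import Literature.NumberTheory.GaloisRepresentations.LubinTateColemanCoordCoinvariantDivisionMaximalTwo
import Literature.NumberTheory.GaloisRepresentations.PotentialDiagonalizabilityCriteriaProofs
import HarnessLib

/-!
# The two-variable Coleman image of a family of tower units indexed by ARBITRARY Galois elements: the cocycle
# `σ_{χ(σ̃_c)}(C g_c • Col β_a) + n_a Col β_c = σ_{χ(σ̃_a)}(C g_a • Col β_c) + n_c Col β_a` from the LEVELWISE unit relation, with `g_{σ̃}` the
# Amice element of `σ̃|_{E_∞}`, and de Shalit II §4.12: **∃! `L_ε ∈ 𝒪_F⟦X⟧⟦T⟧` with `φ_ε(Col β_c) = (t_{χ(σ̃_c)}·g_{σ̃_c} − N_c)·L_ε`** — no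
# «`σ̃` fixes `E_∞`» hypothesis

De Shalit, *Iwasawa theory of elliptic curves with complex multiplication* (1987), I §3.1/§3.4/§3.8 (17) (Coleman's map is a homomorphism of
modules over the completed group ring of the WHOLE Galois group), II §2.4 (ii), §4.12 (29)–(33), §4.14 Step 1 (the two-variable `μ_𝔞 = 12(σ_𝔞 − N𝔞)μ`
with the TRUE Artin symbols `σ_𝔞`, which move the unramified direction).  The sibling `PAdicTwoVariableColemanImageCocycleOfUnits` (g13 S14) proved the
cocycle and the `∃! L` for indices `σ̃_i` FIXING `E_∞`; a global Artin symbol of a non-trivial ideal never fixes `K(𝔤𝔭̄^∞)`, so that version has no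
elliptic-unit instantiation in the two-variable frame.  THIS file removes the restriction, using `colemanImage_galAct` (`Col(σ̃β) = σ_{χ(σ̃)}(C g_{σ̃} • Col β)`,
`LubinTateColemanUnitsImageGaloisTwo`) and the division at a general point of `𝔪_{𝒪⟦X⟧} = (π, X)` (`LubinTateColemanCoordCoinvariantDivisionMaximalTwo`).
Everything PROVED (0 sorry, no definitions, no named facts):

* §1 `colemanDeltaCoinvFun_galOpₗ` — **`φ_ε((𝒯_{v,g,s} G) j) = t_v · C g · φ_ε(G (j − s))`**: every Galois operator is a SCALAR on the `ε`-coinvariants;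
* §2 `colemanImageCoh_galAct_amice` (`Col(σ̃β) = 𝒯_{σ̃}(Col β)` on coherent families), `constantCoeff_eq_one_of_amice` / `isUnit_of_amice` (`g_{σ̃}(0) = 1`),
  `mem_maximalIdeal_powerSeries_iff`, `natCast_mul_inv_sub_one_mem_maximalIdeal` (`n g⁻¹ − 1 ∈ (π, X)` for `π ∣ n − 1`),
  `isAdicComplete_maximalIdeal_powerSeries_integer` (`𝒪_F⟦X⟧` is `(π, X)`-complete — the tree's `powerSeries_isAdicComplete_maximalIdeal`);
* §3 (`d = 1`) ★★ `colemanImageCoh_twistCocycle` — the levelwise relation `(σ̃_c·β_{a,m})·β_{c,m}^{n_a} = (σ̃_a·β_{c,m})·β_{a,m}^{n_c}` for ARBITRARY `σ̃_i ∈ Γ_F`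
  gives `σ_{χ(σ̃_c)}(C g_c • x a) + C n_a • x c = σ_{χ(σ̃_a)}(C g_a • x c) + C n_c • x a`, `x i = Col(β i)`;
  ★★★ **`existsUnique_colemanDeltaCoinvFun_colemanImageCoh_eq_twistMul`** — with `χ_π(σ̃_{a₁}) = γ`, `π ∣ n_{a₁} − 1` and ONE auxiliary `a₂` (non-zero
  Weierstrass value at `b = n_{a₁} g_{a₁}⁻¹ − 1`): **∃! `L ∈ Λ`, `φ_ε(Col(β c)) = (t_{χ(σ̃_c)}·C g_c − C n_c)·L` ∀ `c`**; `map_span_colemanImageCoh_eq_span_twistMul`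
  (`φ_ε(Λ·span Col β) = L·J̃_ε`, `J̃_ε = (t_{χ(σ̃_c)} g_c − n_c : c)` — de Shalit III §1.4 (5) with the true `Λ₀`).

For the elliptic units: `σ̃_𝔞` = any local lift of `(𝔞, K(𝔤p^∞)/K)` (one prime above `𝔭`), `g_𝔞` = Amice element of `σ̃_𝔞|_{K(𝔤𝔭̄^∞)_𝔓}`, `n_𝔞 = N𝔞`.
Cell `bsd-print-cf2`, width seat `bsd-line-cf2c-w7` g14.

## References
* E. de Shalit, *Iwasawa theory of elliptic curves with complex multiplication* (1987), Ch. I §3.1, §3.4 Lemma (ii), §3.8 (17); Ch. II §2.4 (ii),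
  §4.12 (29)–(33), §4.14; Ch. III §1.1 (Exercise (i): `Λ₀ = (σ_𝔞 − N𝔞)`), §1.3, §1.4 (5). [deShalit1987]
* L. C. Washington, *Introduction to Cyclotomic Fields*, 2nd ed. (1997), §7.1 Prop. 7.2. [Washington1997]
-/

noncomputable section

namespace Literature.NumberTheory.EllipticCurves

open ValuativeRel IsLocalRing Field
open Literature.NumberTheory.GaloisRepresentations Literature.NumberTheory.GaloisRepresentations.IsNonarchimedeanLocalField
  Literature.NumberTheory.GaloisRepresentations.LubinTate
open Literature.RingTheory.PowerSeries (maxEval)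

variable {F : Type} [Field F] [ValuativeRel F] [TopologicalSpace F] [IsNonarchimedeanLocalField F]

attribute [local instance] ltNormUniformSpace ltNormIsUniformAddGroup rk1 nF nE fintypeResidueField
attribute [local instance] RelNormCoherentUnits.instCommMonoid

variable {p : ℕ} [hp : Fact p.Prime] {d : ℕ} (hd : d.Coprime p)
variable {π : 𝒪[F]} (hπ : (valuation F).IsUniformizer (π : F))
variable (E : ℕ → IntermediateField F (AlgebraicClosure F)) [∀ m, FiniteDimensional F (E m)] [∀ m, Normal F (E m)]
  [∀ m, IsGalois F (E m)] (hmono : Monotone E) (hE : ∀ m, E m ≤ maxUnramified F) (hdeg : ∀ m, Module.finrank F (E m) = d * p ^ m)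
  {σ₀ : absoluteGaloisGroup F} (hσ₀ : IsAbsArithFrob σ₀) (hq : residueFieldCard F = 2)
variable (u : (LTCoeff F)ˣ) (hu : LTCoeff.of F π = residueFieldCard F * u) (γ : 𝒪[F]ˣ)
variable [IsAdicComplete (Ideal.span {intBase F (LTCoeff.of F π)}) (PowerSeries 𝒪[F])]
variable (w : 𝒪[F]ˣ) (hγ : (γ : 𝒪[F]) = 1 + π ^ 2 * w) (ε : PowerSeries (PowerSeries 𝒪[F])) (hε : ε * ε = 1)

/-! ### §1. Galois operators are scalars on the `ε`-coinvariants -/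

omit hp in
include hε in
/-- ★ **`φ_ε((𝒯_{v,g,s} G) j) = t_v · C g · φ_ε(G (j − s))`**, `t_v = φ_ε(σ_v 1)`: on the `ε`-coinvariants the operator `galOpₗ v g s = σ_v ∘ (C g • ·) ∘ shift_s`
attached to a Galois element is multiplication by the scalar `t_v·C g ∈ Λ` (composed with the `ℤ/d`-shift). [cite: deShalit1987, Ch. I §3.1, §3.4 Lemma (ii); Ch. III §1.8 (14)] -/
theorem colemanDeltaCoinvFun_galOpₗ (v : 𝒪[F]ˣ) (g : PowerSeries 𝒪[F]) (s : ZMod d) (G : ZMod d → ColemanCoordModule hπ hq (intBase F) u hu γ)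
    (j : ZMod d) :
    colemanDeltaCoinvFun hπ hq (intBase F) u hu γ (eq_zero_of_C_pi_mul_eq_zero_integer hπ) w hγ ε (galOpₗ hπ hq u hu γ v g s G j) =
      colemanDeltaCoinvFun hπ hq (intBase F) u hu γ (eq_zero_of_C_pi_mul_eq_zero_integer hπ) w hγ ε
          (unitTwistₗ hπ hq (intBase F) u hu γ v (TActModule.ofPS _ _ 1)) *
        ((PowerSeries.C g : PowerSeries (PowerSeries 𝒪[F])) *
          colemanDeltaCoinvFun hπ hq (intBase F) u hu γ (eq_zero_of_C_pi_mul_eq_zero_integer hπ) w hγ ε (G (j - s))) := by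
  rw [galOpₗ_apply, colemanDeltaCoinvFun_unitTwistₗ hπ hq (intBase F) u hu γ _ w hγ ε hε, map_smul, smul_eq_mul]

/-! ### §2. The Amice element of a Galois index: `Col(σ̃β) = 𝒯_{σ̃}(Col β)`, `g_{σ̃}(0) = 1` -/

variable [NeZero d] [IsAdicComplete (Ideal.span {(p : 𝒪[F])}) 𝒪[F]]
variable {θ : ∀ m, unitBall (E m)} (hθ : ∀ m, IsIntegralNormalGen (E m) (θ m))
  (hcoh : ∀ m, unitBallTrace (hmono (Nat.le_succ m)) (θ (m + 1)) = θ m)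

include hdeg in
/-- **`Col(σ̃·β) = 𝒯_{σ̃}(Col β)` on coherent families**, for EVERY `σ̃ ∈ Γ_F` with Amice pair `(g, s)` of `σ̃|_{E_∞}` (`colemanImage_galAct` read on the
submonoid). [cite: deShalit1987, Ch. I §3.4 Lemma (ii), §3.8 (17); Ch. III §1.3] -/
theorem colemanImageCoh_galAct_amice (β : coherentFamilies hπ E hmono) (σ : absoluteGaloisGroup F) {g : PowerSeries 𝒪[F]} {s : ZMod d}
    (hg : ∀ m, ∃ a : ℕ, (∀ x : E m, σ • (x : AlgebraicClosure F) = (σ₀ ^ a) • (x : AlgebraicClosure F)) ∧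
      ((1 + PowerSeries.X : PowerSeries 𝒪[F]) ^ p ^ m - 1) ∣ g - (1 + PowerSeries.X) ^ a ∧ (a : ZMod d) = s) :
    colemanImageCoh hd hπ E hmono hE hdeg hσ₀ hq u hu γ hθ hcoh (galActCoherent hπ E hmono σ β) =
      galOpₗ hπ hq u hu γ (lubinTateChar hπ σ) g s (colemanImageCoh hd hπ E hmono hE hdeg hσ₀ hq u hu γ hθ hcoh β) := by
  rw [colemanImageCoh_def, colemanImageCoh_def]
  exact colemanImage_galAct hd hπ E hmono hE hdeg hσ₀ hq u hu γ hθ hcoh β.2 σ hg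

omit [ValuativeRel F] [TopologicalSpace F] [IsNonarchimedeanLocalField F] [IsAdicComplete (Ideal.span {(p : 𝒪[F])}) 𝒪[F]]
  [∀ m, FiniteDimensional F (E m)] [∀ m, Normal F (E m)] [∀ m, IsGalois F (E m)] hp [NeZero d] in
/-- **`g_{σ̃}(0) = 1`**: the Amice element is `≡ (1+X)^{a₀}` modulo `ω₀ = X`. [cite: deShalit1987, Ch. I §3.1] -/
theorem constantCoeff_eq_one_of_amice {R : Type*} [CommRing R] {σ : absoluteGaloisGroup F} {g : PowerSeries R} {s : ZMod d}
    (hg : ∀ m, ∃ a : ℕ, (∀ x : E m, σ • (x : AlgebraicClosure F) = (σ₀ ^ a) • (x : AlgebraicClosure F)) ∧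
      ((1 + PowerSeries.X : PowerSeries R) ^ p ^ m - 1) ∣ g - (1 + PowerSeries.X) ^ a ∧ (a : ZMod d) = s) :
    PowerSeries.constantCoeff g = 1 := by
  obtain ⟨a, -, hdvd, -⟩ := hg 0
  rw [pow_zero, pow_one, add_sub_cancel_left] at hdvd
  obtain ⟨k, hk⟩ := hdvd
  have h := congrArg PowerSeries.constantCoeff hk
  rw [map_sub, map_mul, PowerSeries.constantCoeff_X, zero_mul, sub_eq_zero, map_pow, map_add, map_one, PowerSeries.constantCoeff_X,
    add_zero, one_pow] at h
  exact h

omit [ValuativeRel F] [TopologicalSpace F] [IsNonarchimedeanLocalField F] [IsAdicComplete (Ideal.span {(p : 𝒪[F])}) 𝒪[F]]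
  [∀ m, FiniteDimensional F (E m)] [∀ m, Normal F (E m)] [∀ m, IsGalois F (E m)] hp [NeZero d] in
/-- **The Amice element is a unit** of `R⟦X⟧`. [cite: deShalit1987, Ch. I §3.1] -/
theorem isUnit_of_amice {R : Type*} [CommRing R] {σ : absoluteGaloisGroup F} {g : PowerSeries R} {s : ZMod d}
    (hg : ∀ m, ∃ a : ℕ, (∀ x : E m, σ • (x : AlgebraicClosure F) = (σ₀ ^ a) • (x : AlgebraicClosure F)) ∧
      ((1 + PowerSeries.X : PowerSeries R) ^ p ^ m - 1) ∣ g - (1 + PowerSeries.X) ^ a ∧ (a : ZMod d) = s) :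
    IsUnit g := by
  rw [PowerSeries.isUnit_iff_constantCoeff, constantCoeff_eq_one_of_amice E (p := p) hg]
  exact isUnit_one

/-- **`x ∈ 𝔪_{R⟦X⟧} ↔ x(0) ∈ 𝔪_R`** (`R` local). [cite: Washington1997, §7.1] -/
theorem mem_maximalIdeal_powerSeries_iff {R : Type*} [CommRing R] [IsLocalRing R] (x : PowerSeries R) :
    x ∈ maximalIdeal (PowerSeries R) ↔ PowerSeries.constantCoeff x ∈ maximalIdeal R := by
  rw [IsLocalRing.mem_maximalIdeal, IsLocalRing.mem_maximalIdeal, mem_nonunits_iff, mem_nonunits_iff, PowerSeries.isUnit_iff_constantCoeff]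

omit [IsAdicComplete (Ideal.span {intBase F (LTCoeff.of F π)}) (PowerSeries 𝒪[F])] in
include hπ in
/-- A uniformiser lies in the maximal ideal. [cite: Washington1997, §7.1] -/
theorem uniformizer_mem_maximalIdeal : (π : 𝒪[F]) ∈ maximalIdeal 𝒪[F] :=
  (IsLocalRing.mem_maximalIdeal _).mpr (mem_nonunits_iff.mpr (Valuation.IsUniformizer.not_isUnit hπ))

omit [IsAdicComplete (Ideal.span {intBase F (LTCoeff.of F π)}) (PowerSeries 𝒪[F])] in
include hπ in
/-- **`n·g⁻¹ − 1 ∈ 𝔪_{𝒪⟦X⟧} = (π, X)`** for a unit `g` with `g(0) = 1` and `π ∣ n − 1` (an odd norm at `q = 2`): the point at which the index `a₁` divides.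
[cite: deShalit1987, Ch. II §4.12 (32)] -/
theorem natCast_mul_inv_sub_one_mem_maximalIdeal {n : ℕ} (hn : (π : 𝒪[F]) ∣ (n : 𝒪[F]) - 1) (g : (PowerSeries 𝒪[F])ˣ)
    (hg : PowerSeries.constantCoeff (g : PowerSeries 𝒪[F]) = 1) :
    ((n : ℕ) : PowerSeries 𝒪[F]) * ((g⁻¹ : (PowerSeries 𝒪[F])ˣ) : PowerSeries 𝒪[F]) - 1 ∈ maximalIdeal (PowerSeries 𝒪[F]) := by
  rw [mem_maximalIdeal_powerSeries_iff]
  have hinv : PowerSeries.constantCoeff ((g⁻¹ : (PowerSeries 𝒪[F])ˣ) : PowerSeries 𝒪[F]) = 1 := by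
    have h := congrArg PowerSeries.constantCoeff g.inv_mul
    rw [map_mul, hg, mul_one, map_one] at h
    exact h
  rw [map_sub, map_mul, map_natCast, hinv, mul_one, map_one]
  obtain ⟨k, hk⟩ := hn
  rw [hk]
  exact Ideal.mul_mem_right _ _ (uniformizer_mem_maximalIdeal hπ)

/-- **`𝒪_F⟦X⟧` is complete for its maximal ideal `(π, X)`** (power series over the complete local ring `𝒪_F`). [cite: Washington1997, §7.1] -/
theorem isAdicComplete_maximalIdeal_powerSeries_integer : IsAdicComplete (maximalIdeal (PowerSeries 𝒪[F])) (PowerSeries 𝒪[F]) :=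
  powerSeries_isAdicComplete_maximalIdeal

attribute [local instance] isAdicComplete_maximalIdeal_powerSeries_integer

/-! ### §3. The cocycle and the divided element for Galois-indexed families (`d = 1`) -/

section Cyclic

variable [Unique (ZMod d)]

include hdeg in
/-- ★★ **The LEVELWISE unit relation for ARBITRARY Galois indices IS the `g`-twisted cocycle**: if at every level `m`
`(σ̃_c·β_{a,m})·β_{c,m}^{n_a} = (σ̃_a·β_{c,m})·β_{a,m}^{n_c}` (`σ̃_i ∈ Γ_F` with Amice pairs `(g_i, s_i)`; NO condition on `σ̃_i|_{E_∞}`), then `x i := Col(β i) j` satisfies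
`σ_{χ(σ̃_c)}(C g_c • x a) + C n_a • x c = σ_{χ(σ̃_a)}(C g_a • x c) + C n_c • x a`. [cite: deShalit1987, Ch. II §2.4 (ii), §4.12 (29), §4.14; Ch. I §3.8 (17)] -/
theorem colemanImageCoh_twistCocycle {I : Type*} (β : I → coherentFamilies hπ E hmono) (σ : I → absoluteGaloisGroup F)
    (g : I → (PowerSeries 𝒪[F])ˣ) (s : I → ZMod d)
    (hg : ∀ i m, ∃ a : ℕ, (∀ x : E m, σ i • (x : AlgebraicClosure F) = (σ₀ ^ a) • (x : AlgebraicClosure F)) ∧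
      ((1 + PowerSeries.X : PowerSeries 𝒪[F]) ^ p ^ m - 1) ∣ (g i : PowerSeries 𝒪[F]) - (1 + PowerSeries.X) ^ a ∧ (a : ZMod d) = s i)
    (n : I → ℕ)
    (hrel : ∀ (a c : I) (m : ℕ), ((β a).1 m).galAct (σ c) * (β c).1 m ^ n a = ((β c).1 m).galAct (σ a) * (β a).1 m ^ n c)
    (a c : I) (j : ZMod d) :
    unitTwistₗ hπ hq (intBase F) u hu γ (lubinTateChar hπ (σ c))
        ((PowerSeries.C (g c : PowerSeries 𝒪[F]) : PowerSeries (PowerSeries 𝒪[F])) •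
          colemanImageCoh hd hπ E hmono hE hdeg hσ₀ hq u hu γ hθ hcoh (β a) j) +
        (PowerSeries.C ((n a : ℕ) : PowerSeries 𝒪[F]) : PowerSeries (PowerSeries 𝒪[F])) •
          colemanImageCoh hd hπ E hmono hE hdeg hσ₀ hq u hu γ hθ hcoh (β c) j =
      unitTwistₗ hπ hq (intBase F) u hu γ (lubinTateChar hπ (σ a))
        ((PowerSeries.C (g a : PowerSeries 𝒪[F]) : PowerSeries (PowerSeries 𝒪[F])) •
          colemanImageCoh hd hπ E hmono hE hdeg hσ₀ hq u hu γ hθ hcoh (β c) j) +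
        (PowerSeries.C ((n c : ℕ) : PowerSeries 𝒪[F]) : PowerSeries (PowerSeries 𝒪[F])) •
          colemanImageCoh hd hπ E hmono hE hdeg hσ₀ hq u hu γ hθ hcoh (β a) j := by
  have hrel' : ∀ a c : I, galActCoherent hπ E hmono (σ c) (β a) * β c ^ n a = galActCoherent hπ E hmono (σ a) (β c) * β a ^ n c :=
    fun a c => Subtype.ext (funext fun m => by
      simp only [Submonoid.coe_mul, SubmonoidClass.coe_pow, Pi.mul_apply, Pi.pow_apply, coe_galActCoherent]
      exact hrel a c m)
  have h := twist_cocycle_of_map_mul_of_rel (R := PowerSeries (PowerSeries 𝒪[F]))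
    (colemanImageCoh hd hπ E hmono hE hdeg hσ₀ hq u hu γ hθ hcoh) (colemanImageCoh_mul hd hπ E hmono hE hdeg hσ₀ hq u hu γ hθ hcoh)
    (colemanImageCoh_one hd hπ E hmono hE hdeg hσ₀ hq u hu γ hθ hcoh) (fun i => galActCoherent hπ E hmono (σ i))
    (fun i G => galOpₗ hπ hq u hu γ (lubinTateChar hπ (σ i)) (g i : PowerSeries 𝒪[F]) (s i) G)
    (fun i b => colemanImageCoh_galAct_amice hd hπ E hmono hE hdeg hσ₀ hq u hu γ hθ hcoh b (σ i) (hg i)) β n hrel' a c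
  have hj := congrFun h j
  rw [Pi.add_apply, Pi.add_apply, Pi.smul_apply, Pi.smul_apply, galOpₗ_apply, galOpₗ_apply,
    Subsingleton.elim (j - s c) j, Subsingleton.elim (j - s a) j] at hj
  rwa [map_natCast, map_natCast]

include hdeg hε in
/-- ★★★ **DE SHALIT II §4.12 IN THE TWO-VARIABLE FRAME FOR GALOIS-INDEXED FAMILIES** (`ε`-part, one prime, `q = 2`, `d = 1`): let the coherent
tower families `β_c` satisfy the levelwise relation of `colemanImageCoh_twistCocycle` for indices `σ̃_c ∈ Γ_F` with Amice pairs `(g_c, s_c)` (arbitrary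
action on `E_∞`), let `a₁` have `χ_π(σ̃_{a₁}) = γ` and `π ∣ n_{a₁} − 1`, and let ONE index `a₂` have non-zero Weierstrass value
`(t_{χ(σ̃_{a₂})} − C(n_{a₂} g_{a₂}⁻¹))(n_{a₁} g_{a₁}⁻¹ − 1) ≠ 0` in `𝒪_F⟦X⟧`.  Then **there is a UNIQUE `L ∈ Λ = 𝒪_F⟦X⟧⟦T⟧` with
`φ_ε(Col(β c) j) = (t_{χ(σ̃_c)}·C g_c − C n_c)·L` for every `c`** — de Shalit's two-variable `μ` (`ε`-part) from `μ_𝔞 = (σ_𝔞 − N𝔞)μ` with the TRUE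
Artin symbols. [cite: deShalit1987, Ch. II §4.12 (29)–(33), §4.14 Step 1; Ch. III §1.4 (5)] [cite: Washington1997, §7.1 Prop. 7.2] -/
theorem existsUnique_colemanDeltaCoinvFun_colemanImageCoh_eq_twistMul {I : Type*} (β : I → coherentFamilies hπ E hmono)
    (σ : I → absoluteGaloisGroup F) (g : I → (PowerSeries 𝒪[F])ˣ) (s : I → ZMod d)
    (hg : ∀ i m, ∃ a : ℕ, (∀ x : E m, σ i • (x : AlgebraicClosure F) = (σ₀ ^ a) • (x : AlgebraicClosure F)) ∧
      ((1 + PowerSeries.X : PowerSeries 𝒪[F]) ^ p ^ m - 1) ∣ (g i : PowerSeries 𝒪[F]) - (1 + PowerSeries.X) ^ a ∧ (a : ZMod d) = s i)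
    (n : I → ℕ)
    (hrel : ∀ (a c : I) (m : ℕ), ((β a).1 m).galAct (σ c) * (β c).1 m ^ n a = ((β c).1 m).galAct (σ a) * (β a).1 m ^ n c)
    (a₁ a₂ : I) (hv₁ : lubinTateChar hπ (σ a₁) = γ) (hn₁ : (π : 𝒪[F]) ∣ (n a₁ : 𝒪[F]) - 1)
    (ha₂ : maxEval (natCast_mul_inv_sub_one_mem_maximalIdeal hπ hn₁ (g a₁) (constantCoeff_eq_one_of_amice E (p := p) (hg a₁)))
      (colemanDeltaCoinvFun hπ hq (intBase F) u hu γ (eq_zero_of_C_pi_mul_eq_zero_integer hπ) w hγ ε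
          (unitTwistₗ hπ hq (intBase F) u hu γ (lubinTateChar hπ (σ a₂)) (TActModule.ofPS _ _ 1)) -
        PowerSeries.C (((n a₂ : ℕ) : PowerSeries 𝒪[F]) * ((g a₂)⁻¹ : (PowerSeries 𝒪[F])ˣ))) ≠ 0) (j : ZMod d) :
    ∃! L : PowerSeries (PowerSeries 𝒪[F]), ∀ c : I,
      colemanDeltaCoinvFun hπ hq (intBase F) u hu γ (eq_zero_of_C_pi_mul_eq_zero_integer hπ) w hγ ε
          (colemanImageCoh hd hπ E hmono hE hdeg hσ₀ hq u hu γ hθ hcoh (β c) j) =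
        (colemanDeltaCoinvFun hπ hq (intBase F) u hu γ (eq_zero_of_C_pi_mul_eq_zero_integer hπ) w hγ ε
            (unitTwistₗ hπ hq (intBase F) u hu γ (lubinTateChar hπ (σ c)) (TActModule.ofPS _ _ 1)) *
            PowerSeries.C (g c : PowerSeries 𝒪[F]) - PowerSeries.C ((n c : ℕ) : PowerSeries 𝒪[F])) * L :=
  existsUnique_colemanDeltaCoinvFun_eq_twistMul_of_rel hπ hq (intBase F) u hu γ (eq_zero_of_C_pi_mul_eq_zero_integer hπ) w hγ ε hε
    (fun c => colemanImageCoh hd hπ E hmono hE hdeg hσ₀ hq u hu γ hθ hcoh (β c) j) (fun c => lubinTateChar hπ (σ c)) g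
    (fun c => ((n c : ℕ) : PowerSeries 𝒪[F]))
    (fun a c => colemanImageCoh_twistCocycle hd hπ E hmono hE hdeg hσ₀ hq u hu γ hθ hcoh β σ g s hg n hrel a c j) a₁ a₂ hv₁ _ ha₂

omit [Unique (ZMod d)] in
include hdeg in
/-- ★ **`φ_ε(Λ·span{Col β_c}) = span{(t_{χ(σ̃_c)}·C g_c − C n_c)·L}`** — de Shalit III §1.4 (5) `i(𝒞_𝔣) = μ(𝔣)·Λ₀` on the `ε`-part with the TRUE
`Λ₀ = (σ_𝔞 − N𝔞 : 𝔞)` (III §1.1 Exercise (i)), for any `L` with the property of `existsUnique_colemanDeltaCoinvFun_colemanImageCoh_eq_twistMul`.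
[cite: deShalit1987, Ch. III §1.1, §1.4 (5); Ch. II §4.12 (33)] -/
theorem map_span_colemanImageCoh_eq_span_twistMul {I : Type*} (β : I → coherentFamilies hπ E hmono) (σ : I → absoluteGaloisGroup F)
    (g : I → (PowerSeries 𝒪[F])ˣ) (n : I → ℕ) (j : ZMod d) (L : PowerSeries (PowerSeries 𝒪[F]))
    (hL : ∀ c : I, colemanDeltaCoinvFun hπ hq (intBase F) u hu γ (eq_zero_of_C_pi_mul_eq_zero_integer hπ) w hγ ε
          (colemanImageCoh hd hπ E hmono hE hdeg hσ₀ hq u hu γ hθ hcoh (β c) j) =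
        (colemanDeltaCoinvFun hπ hq (intBase F) u hu γ (eq_zero_of_C_pi_mul_eq_zero_integer hπ) w hγ ε
            (unitTwistₗ hπ hq (intBase F) u hu γ (lubinTateChar hπ (σ c)) (TActModule.ofPS _ _ 1)) *
            PowerSeries.C (g c : PowerSeries 𝒪[F]) - PowerSeries.C ((n c : ℕ) : PowerSeries 𝒪[F])) * L) :
    (Submodule.span (PowerSeries (PowerSeries 𝒪[F]))
        (Set.range fun c => colemanImageCoh hd hπ E hmono hE hdeg hσ₀ hq u hu γ hθ hcoh (β c) j)).map
        (colemanDeltaCoinvFun hπ hq (intBase F) u hu γ (eq_zero_of_C_pi_mul_eq_zero_integer hπ) w hγ ε) =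
      Ideal.span (Set.range fun c =>
        (colemanDeltaCoinvFun hπ hq (intBase F) u hu γ (eq_zero_of_C_pi_mul_eq_zero_integer hπ) w hγ ε
            (unitTwistₗ hπ hq (intBase F) u hu γ (lubinTateChar hπ (σ c)) (TActModule.ofPS _ _ 1)) *
            PowerSeries.C (g c : PowerSeries 𝒪[F]) - PowerSeries.C ((n c : ℕ) : PowerSeries 𝒪[F])) * L) :=
  colemanDeltaCoinvFun_map_span_range_eq_span_twistMul hπ hq (intBase F) u hu γ (eq_zero_of_C_pi_mul_eq_zero_integer hπ) w hγ ε
    (fun c => colemanImageCoh hd hπ E hmono hE hdeg hσ₀ hq u hu γ hθ hcoh (β c) j) (fun c => lubinTateChar hπ (σ c)) g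
    (fun c => ((n c : ℕ) : PowerSeries 𝒪[F])) L hL

end Cyclic

end Literature.NumberTheory.EllipticCurves
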